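import Summits.NavierStokesRegularity.NavierStokesRegularity.Theorems.ExtremiserTransienceMultiscaleCrowdingPacking
import Summits.NavierStokesRegularity.NavierStokesRegularity.Theorems.ExtremiserTransienceBackwardConePropagation
import HarnessLib

/-!
# LINE g10-γ «multiscale crowding» (crux 26567): the LOCAL CROWDING LIOUVILLE THEOREM — unconditional

Helper file for the crux `NearExtremalTransiencePerFlow` (stmt-NavierStokesRegularity-26567), LINE g10-γ `multiscale_crowding` (skeleton of
record 1c5b3d804149).  Ports of the author's kernel-checked in-file pieces (planner ns-idea-5 g10; `E3` spelled out) over the texts of record,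
and their UNCONDITIONAL assembly now that the analytic stubs are theorems of the tree:

* `CrowdingConfig.mono`, `multiscaleCrowding_of_chains` (β's chains crowd at every scale: T♮ ⇒ T♭ on the geometric side);
* `localCrowdingLiouville_of_ledger`, `localCrowdingLiouville_of` (L3ᵐˢ + L1ᵘ + L2 + the landed backward-cone propagation ⇒ the theorem);
* `localCrowdingLiouville : LocalCrowdingLiouville` — UNCONDITIONAL: L1ᵘ = `DissipationLedger.stub_uniformDissipationBudget` (ns-net-p2 g10,
  p706162) and L2 = `DissipationLedger.stub_violatorDissipation` (ns-net-p1 g11, p704994): for all `K, A, C > 0, η > 0, s < 0` there are `m, ℓ₀ > 0`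
  such that no slice `W s` of a Type-I ancient mild field (constant `K`) with all-time linear growth `A` carries an `(m, ℓ₀, C, η)` crowding
  configuration.

HONEST FRAMING: a Liouville-type statement about hypothetical Type-I ancient fields with linear growth; the heart T♭ and the crux stay OPEN;
nothing about Navier–Stokes regularity or blow-up is proved; no summit is proved by a line. [folklore]
-/

noncomputable section

open scoped Topology InnerProductSpace RealInnerProductSpace ENNReal ContDiff
open MeasureTheory Filter Set Metric Function
open Literature.Analysis Literature.Analysis.FluidPDE
open Summit.NavierStokesRegularity.NavierStokesRegularity.Theses.ExtremiserTransience
open Summit.NavierStokesRegularity.NavierStokesRegularity.Theorems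
open Summit.NavierStokesRegularity.NavierStokesRegularity.Theorems.NearExtremalTransiencePerFlow
open Summit.NavierStokesRegularity.NavierStokesRegularity.Theorems.NearExtremalTransiencePerFlow.ZoneTransversality
open Summit.NavierStokesRegularity.NavierStokesRegularity.Theorems.NearExtremalTransiencePerFlow.MemberSelection
open Summit.NavierStokesRegularity.NavierStokesRegularity.Theorems.NearExtremalTransiencePerFlow.DissipationLedger
  (HasLinGrowthAllTime dissMeasure ViolatorDissipation stub_uniformDissipationBudget stub_violatorDissipation)
open Summit.NavierStokesRegularity.NavierStokesRegularity.Theorems.NearExtremalTransiencePerFlow.TightOrChain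
  (UniformDissipationBudget ChainUpTo ChainsOfEveryLength)

namespace Summit.NavierStokesRegularity.NavierStokesRegularity.Theorems

set_option linter.dupNamespace false

namespace NearExtremalTransiencePerFlow.MultiscaleCrowding

/-! ### Monotonicity and the comparison with β's chains -/

/-- Monotonicity in the density: crowding with density `C` is crowding with any smaller density. -/
theorem CrowdingConfig.mono {m : ℕ} {ℓ₀ C C' η : ℝ} {w : (EuclideanSpace ℝ (Fin 3)) → (EuclideanSpace ℝ (Fin 3))} (hℓ₀ : 0 < ℓ₀) (hCC' : C' ≤ C)
    (h : CrowdingConfig m ℓ₀ C η w) : CrowdingConfig m ℓ₀ C' η w := by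
  obtain ⟨z₀, L, k, hk, hkL, hS⟩ := h
  refine ⟨z₀, L, k, hk, hkL, fun j hj => ?_⟩
  obtain ⟨S, hcard, hmem, hsep⟩ := hS j hj
  refine ⟨S, le_trans ?_ hcard, hmem, hsep⟩
  rcases Nat.eq_zero_or_pos m with hm | hm
  · omega
  have hL : 0 ≤ L := by
    have h0 := hkL j hj
    have h1 : 0 < ℓ₀ * 6 ^ (k j) := by positivity
    linarith
  exact div_le_div_of_nonneg_right (mul_le_mul_of_nonneg_right hCC' hL) (by positivity)

/-- **Chains crowd at every scale** (so β's non-tight branch implies γ's, with density `1/4`): from a chain of thickness `g` and length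
`L = ℓ₀6^{k₀+m}` about `z₀` one extracts, at each scale `ℓ = ℓ₀6^{k₀+j} ≥ 4g`, the points near the spheres of radii `0, 2ℓ, 4ℓ, …`
(`⌊L/4ℓ⌋ + 1` of them): they are `ℓ`-separated and lie in `B̄(z₀, L)`. -/
theorem multiscaleCrowding_of_chains {g η : ℝ} {w : (EuclideanSpace ℝ (Fin 3)) → (EuclideanSpace ℝ (Fin 3))} (_hg : 0 ≤ g) (h : ChainsOfEveryLength g η w) :
    MultiscaleCrowding (1 / 4) η w := by
  intro m ℓ₀ hℓ₀
  -- a first exponent `k₀` with `4 g ≤ ℓ₀ 6^{k₀}`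
  obtain ⟨k₀, hk₀⟩ : ∃ k₀ : ℕ, 4 * g / ℓ₀ < 6 ^ k₀ := pow_unbounded_of_one_lt _ (by norm_num)
  have hk₀' : 4 * g ≤ ℓ₀ * 6 ^ k₀ := by
    rw [div_lt_iff₀ hℓ₀] at hk₀; linarith
  -- the radius and the chain
  obtain ⟨L, hL⟩ : ∃ L : ℝ, L = ℓ₀ * 6 ^ (k₀ + m) := ⟨_, rfl⟩
  have hLpos : 0 < L := by rw [hL]; positivity
  obtain ⟨z₀, hch⟩ := h L
  refine ⟨z₀, L, fun j => k₀ + j, fun i j hij => by dsimp; omega, fun j hj => ?_, fun j hj => ?_⟩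
  · rw [hL]
    exact mul_le_mul_of_nonneg_left (pow_le_pow_right₀ (by norm_num) (by dsimp only; omega)) hℓ₀.le
  -- the scale `ℓ`
  obtain ⟨ℓ, hℓ⟩ : ∃ ℓ : ℝ, ℓ = ℓ₀ * 6 ^ (k₀ + j) := ⟨_, rfl⟩
  have hℓpos : 0 < ℓ := by rw [hℓ]; positivity
  have hgℓ : 4 * g ≤ ℓ := by
    rw [hℓ, pow_add, ← mul_assoc]
    exact hk₀'.trans (le_mul_of_one_le_right (by positivity) (one_le_pow₀ (by norm_num)))
  have hℓL : ℓ ≤ L := by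
    rw [hℓ, hL]; exact mul_le_mul_of_nonneg_left (pow_le_pow_right₀ (by norm_num) (by omega)) hℓ₀.le
  -- the number of points
  obtain ⟨n, hn⟩ : ∃ n : ℕ, n = ⌊L / (4 * ℓ)⌋₊ + 1 := ⟨_, rfl⟩
  have hnge : L / (4 * ℓ) ≤ (n : ℝ) := by
    rw [hn]; push_cast; exact (Nat.lt_floor_add_one _).le
  have hnle : ((n : ℝ) - 1) ≤ L / (4 * ℓ) := by
    rw [hn]; push_cast
    have := Nat.floor_le (show 0 ≤ L / (4 * ℓ) by positivity)
    linarith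
  -- the points near the spheres of radii `2 i ℓ`, `i < n`
  have hrad : ∀ i : ℕ, i < n → (2 * (i : ℝ) * ℓ ≤ L / 2) := by
    intro i hi
    have h1 : (i : ℝ) ≤ n - 1 := by
      have : (i : ℝ) + 1 ≤ n := by exact_mod_cast hi
      linarith
    have h2 : (i : ℝ) ≤ L / (4 * ℓ) := h1.trans hnle
    rw [le_div_iff₀ (by positivity)] at h2
    linarith
  have hz : ∀ i : ℕ, ∃ z : (EuclideanSpace ℝ (Fin 3)), i < n → |‖z - z₀‖ - 2 * i * ℓ| ≤ g ∧ η ≤ ‖w z‖ := by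
    intro i
    by_cases hi : i < n
    · obtain ⟨z, h1, h2⟩ := hch (2 * i * ℓ) (by positivity) (by linarith [hrad i hi, hLpos])
      exact ⟨z, fun _ => ⟨h1, h2⟩⟩
    · exact ⟨z₀, fun h' => absurd h' hi⟩
  choose z hz using hz
  -- separation of the points
  have hsep : ∀ i i' : ℕ, i < i' → i' < n → ℓ ≤ ‖z i - z i'‖ := by
    intro i i' hii' hi'
    have hi : i < n := hii'.trans hi'
    have h1 := abs_le.1 (hz i hi).1
    have h2 := abs_le.1 (hz i' hi').1
    have hic : (i : ℝ) + 1 ≤ i' := by exact_mod_cast hii'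
    have h3 : ‖z i' - z₀‖ - ‖z i - z₀‖ ≤ ‖z i - z i'‖ := by
      have e : z i - z i' = (z i - z₀) - (z i' - z₀) := by abel
      rw [e, norm_sub_rev (z i - z₀) (z i' - z₀)]; exact norm_sub_norm_le _ _
    nlinarith [h1.2, h2.1, hℓpos, hgℓ]
  have hinj : Set.InjOn z ↑(Finset.range n) := by
    intro i hi i' hi' hzz
    have hi := Finset.mem_range.1 (Finset.mem_coe.1 hi)
    have hi' := Finset.mem_range.1 (Finset.mem_coe.1 hi')
    by_contra hne
    rcases lt_or_gt_of_ne hne with hlt | hgt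
    · have h := hsep i i' hlt hi'
      rw [hzz, sub_self, norm_zero] at h
      linarith
    · have h := hsep i' i hgt hi
      rw [hzz, sub_self, norm_zero] at h
      linarith
  refine ⟨(Finset.range n).image z, ?_, ?_, ?_⟩
  · rw [Finset.card_image_of_injOn hinj, Finset.card_range, ← hℓ]
    calc 1 / 4 * L / ℓ = L / (4 * ℓ) := by field_simp
      _ ≤ n := hnge
  · intro x hx
    obtain ⟨i, hi, rfl⟩ := Finset.mem_image.1 hx
    have hi' := Finset.mem_range.1 hi
    refine ⟨?_, (hz i hi').2⟩
    have h1 := (abs_le.1 (hz i hi').1).2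
    linarith [hrad i hi', hgℓ, hℓL, hLpos]
  · intro x hx x' hx' hxx
    obtain ⟨i, hi, rfl⟩ := Finset.mem_image.1 hx
    obtain ⟨i', hi', rfl⟩ := Finset.mem_image.1 hx'
    have hin := Finset.mem_range.1 hi
    have hin' := Finset.mem_range.1 hi'
    rw [← hℓ]
    rcases lt_trichotomy i i' with hlt | heq | hgt
    · exact hsep i i' hlt hin'
    · exact absurd (by rw [heq]) hxx
    · rw [norm_sub_rev]; exact hsep i' i hgt hin

/-! ### The ledger gives the local crowding Liouville theorem -/


/-- **Local crowding Liouville from the multiscale ledger.**  Level `ε = min(ε₁, η√(-s)/2)`; `m` from L3ᵐˢ; `ℓ₀ = (2ρ+2D+2)√(-s)`. -/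
theorem localCrowdingLiouville_of_ledger (h3 : MultiscaleLedgerCount) (h1 : UniformDissipationBudget) (h2 : ViolatorDissipation) :
    LocalCrowdingLiouville := by
  intro K A C η s hs hC hη
  obtain ⟨ε₁, hε₁, hper⟩ := ScrewSymmetricLiouville.exists_backwardCone_violator
  have hsq : 0 < Real.sqrt (-s) := Real.sqrt_pos.2 (neg_pos.2 hs)
  obtain ⟨ε, hε, hεε₁, hεη⟩ : ∃ ε : ℝ, 0 < ε ∧ ε ≤ ε₁ ∧ ε < η * Real.sqrt (-s) := by
    refine ⟨min ε₁ (η * Real.sqrt (-s) / 2), lt_min hε₁ (by positivity), min_le_left _ _, ?_⟩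
    have h1 : η * Real.sqrt (-s) / 2 < η * Real.sqrt (-s) := half_lt_self (by positivity)
    exact lt_of_le_of_lt (min_le_right _ _) h1
  obtain ⟨ρ, hρ, hρW⟩ := hper ε hε hεε₁ K
  obtain ⟨c, D, a, hc, hD, ha, ha1, hsp⟩ := h2 K A ε hε
  obtain ⟨E, hE⟩ := h1 K A
  obtain ⟨m, hcount⟩ := h3 s ρ c D a E C hs hρ hc hD ha ha1 hC
  refine ⟨m, (2 * ρ + 2 * D + 2) * Real.sqrt (-s), by positivity, fun W hW hgr hconf => ?_⟩
  obtain ⟨z₀, L, k, hk, hkL, hS⟩ := hconf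
  refine hcount (dissMeasure W) (fun τ x => ε < Real.sqrt (-τ) * ‖W τ x‖) z₀ L k hk hkL ?_ ?_ ?_ ?_
  · intro j hj
    obtain ⟨S, hcard, hmem, hsep⟩ := hS j hj
    refine ⟨S, hcard, fun z hz => ⟨(hmem z hz).1, ?_⟩, hsep⟩
    show ε < Real.sqrt (-s) * ‖W s z‖
    calc ε < η * Real.sqrt (-s) := hεη
      _ = Real.sqrt (-s) * η := mul_comm _ _
      _ ≤ Real.sqrt (-s) * ‖W s z‖ := by gcongr; exact (hmem z hz).2
  · intro τ x hτ hP
    exact hρW W hW τ hτ x hP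
  · intro τ x hτ hP
    exact hsp W hW hgr τ x hτ hP
  · intro R τ₁ τ₂ hR h12 h2' hτR
    exact hE W hW hgr z₀ R τ₁ τ₂ hR h12 h2' hτR

set_option maxHeartbeats 1600000 in
/-- The local crowding Liouville theorem from the two ANALYTIC stubs only (L3ᵐˢ proved above). -/
theorem localCrowdingLiouville_of (hL1 : UniformDissipationBudget) (hL2 : ViolatorDissipation) : LocalCrowdingLiouville :=
  localCrowdingLiouville_of_ledger multiscaleLedgerCount_holds hL1 hL2

/-- **THE LOCAL CROWDING LIOUVILLE THEOREM, UNCONDITIONAL**: `localCrowdingLiouville_of` with the landed analytic stubs L1ᵘ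
(`DissipationLedger.stub_uniformDissipationBudget`, p706162) and L2 (`DissipationLedger.stub_violatorDissipation`, p704994). [folklore] -/
theorem localCrowdingLiouville : LocalCrowdingLiouville :=
  localCrowdingLiouville_of stub_uniformDissipationBudget stub_violatorDissipation

end NearExtremalTransiencePerFlow.MultiscaleCrowding

end Summit.NavierStokesRegularity.NavierStokesRegularity.Theorems

end
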